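import Summits.AtomisticToContinuum.FouriersLaw.Theses.OddSectorIrreversibility
import Summits.AtomisticToContinuum.FouriersLaw.Theorems.ConductanceLowerBound.Negative.GammaZeroNonUniqueness
import Literature.Barriers.AtomisticToContinuum.HarmonicCrystalBallisticProofs

/-!
# `BoundedResponseConverges` / Negative: load-bearing analysis of the import slot

Negative knowledge for crux `stmt-AtomisticToContinuum-9141`
(`OddSectorIrreversibility.BoundedResponseConverges`; verbatim import slot also of
`TransferKernelPositivity`, `LocalOhmBV`, `MatthiessenLadder`), crux disprover, cycle 1 (2026-08-16).
The crux: for `pinnedChain ω₂ lam β γ` (all `> 0`), under weak-NESS uniqueness, along every steady-state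
family and every `T > 0`, if the response coefficients `D N` exist for all `N` and `(|D N|)` is bounded
then `D N → k` for some `k > 0`.

* `not_fouriersLaw_of_not_boundedResponseConverges` — WHY IT RESISTS: the crux is a corollary of the
  sub-problem statement (`𝓝[≠] 0`-limits are unique, so `D` IS the conjunct's response sequence, which
  converges to `κ T > 0`); a refutation of the crux is a refutation of `FouriersLaw`, hence of the summit
  (`not_atomisticToContinuum_of_not_boundedResponseConverges`).
* `boundedResponseConverges_harmonic_corner` — `0 < lam`, `0 < β` are NOT where a counterexample lives:
  at the solvable corner `lam = β = 0` (ballistic law `HarmonicChainBallisticFlux_holds`) the crux's matrix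
  HOLDS, vacuously (every admissible response sequence is unbounded), while the strengthening WITHOUT the
  boundedness hypothesis FAILS there along the Gaussian family
  (`boundedResponseConverges_false_without_bddAbove_harmonic`).
* `boundedResponseConverges_false_without_unique_gamma_zero` — uniqueness and `0 < γ` are jointly
  load-bearing: at `γ = 0` every Gibbs measure is steady for all bath temperatures
  (`pinnedChain_isSteadyState_gibbs_gamma_zero`), the Gibbs family carries no current, `D ≡ 0` is bounded
  and `0 ≯ 0`; with the uniqueness antecedent kept the matrix is VACUOUS at `γ = 0`
  (`boundedResponseConverges_vacuous_gamma_zero`, from `pinnedChain_not_unique_gamma_zero`).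
* `boundedResponseConverges_skeleton_insulating`, `boundedResponseConverges_skeleton_oscillating` — the two
  printed failure modes (limit `0`; bounded oscillation) are consistent with all sequence-level
  information extractable today (`D 0 = D 1 = 0`, `|D|` bounded, even positivity / two-sided bounds):
  a proof needs an `N`-uniform lower bound AND a convergence mechanism in `N`.
Nothing here closes an item.
-/

noncomputable section

namespace Summit.AtomisticToContinuum.FouriersLaw.Theorems

open MeasureTheory Filter Topology
open Literature.MathematicalPhysics.KineticTheory.HeatConduction
open Summit.AtomisticToContinuum.FouriersLaw.Theses.OddSectorIrreversibility (BoundedResponseConverges)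

/-- **A refutation of the crux refutes the conjunct.** `FouriersLaw → BoundedResponseConverges`
(clause (ii) supplies coefficients with the same `𝓝[≠] 0`-limits converging to `κ T > 0`; limits along
the proper filter `𝓝[≠] 0` are unique), stated contrapositively. Neither the uniqueness nor the
boundedness hypothesis of the crux is used. [cite: BonettoLebowitzReyBellet2000, §5.3 eq. (33)] -/
theorem not_fouriersLaw_of_not_boundedResponseConverges (h : ¬ BoundedResponseConverges) :
    ¬ _root_.FouriersLaw := by
  intro hF
  apply h
  intro ω₂ lam β γ hω hl hβ hγ _hu μ hμ T hT D hD _hB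
  obtain ⟨-, κ, hκ, hall⟩ := hF ω₂ lam β γ hω hl hβ hγ
  obtain ⟨D', hD', hlim⟩ := hall μ hμ T hT
  have hDD : D = D' := funext fun N => tendsto_nhds_unique (hD N) (hD' N)
  subst hDD
  exact ⟨κ T, hκ T hT, hlim⟩

/-- … hence it refutes the summit `AtomisticToContinuum`. [folklore] -/
theorem not_atomisticToContinuum_of_not_boundedResponseConverges (h : ¬ BoundedResponseConverges) :
    ¬ _root_.AtomisticToContinuum := fun hA =>
  not_fouriersLaw_of_not_boundedResponseConverges h hA.2.1

/-- **Harmonic corner (`lam = β = 0`): the crux's matrix holds — vacuously.** For `ω₂, γ > 0`, under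
the (hypothetical) uniqueness antecedent, along every steady family of `pinnedChain ω₂ 0 0 γ` and every
`T > 0`, an admissible response sequence is never bounded (it agrees with `D_{M+1} = M c_{M+1} → +∞` of
the Gaussian family, the two families coinciding once `T ± δ/2 > 0`), so the implication holds. The one
solvable member of the family cannot refute the crux. [cite: BonettoLebowitzReyBellet2000, §6.2] -/
theorem boundedResponseConverges_harmonic_corner {ω₂ γ : ℝ} (hω : 0 < ω₂) (hγ : 0 < γ) :
    (∀ (N : ℕ) (T_L T_R : ℝ), 0 < T_L → 0 < T_R → ∀ μ ν : Measure (PhaseSpace N),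
      (pinnedChain ω₂ 0 0 γ).IsSteadyState N T_L T_R μ →
        (pinnedChain ω₂ 0 0 γ).IsSteadyState N T_L T_R ν → μ = ν) →
    ∀ μ : (N : ℕ) → ℝ → ℝ → Measure (PhaseSpace N),
      (∀ (N : ℕ) (T_L T_R : ℝ), 0 < T_L → 0 < T_R →
        (pinnedChain ω₂ 0 0 γ).IsSteadyState N T_L T_R (μ N T_L T_R)) →
      ∀ T : ℝ, 0 < T → ∀ D : ℕ → ℝ,
        (∀ N : ℕ, Tendsto (fun δ : ℝ =>
          (pinnedChain ω₂ 0 0 γ).totalCurrent (μ N (T + δ / 2) (T - δ / 2)) / δ)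
          (𝓝[≠] 0) (𝓝 (D N))) →
        BddAbove (Set.range fun N => |D N|) → ∃ k : ℝ, 0 < k ∧ Tendsto D atTop (𝓝 k) := by
  intro hu μ hμ T hT D hD hB
  exfalso
  obtain ⟨μ₀, hμ₀, c, cinf, -, hresp, -, hdiv⟩ :=
    Literature.Barriers.AtomisticToContinuum.HarmonicChainBallisticFlux_holds.ballisticLaw hω hγ
  -- transfer the response limits from `μ` to the Gaussian family `μ₀` (uniqueness)
  have hval : ∀ M : ℕ, D (M + 1) = M * c (M + 1) := by
    intro M
    have heq : ∀ᶠ δ in 𝓝[≠] (0 : ℝ),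
        (pinnedChain ω₂ 0 0 γ).totalCurrent (μ (M + 1) (T + δ / 2) (T - δ / 2)) / δ =
          (pinnedChain ω₂ 0 0 γ).totalCurrent (μ₀ (M + 1) (T + δ / 2) (T - δ / 2)) / δ := by
      have h2 : ∀ᶠ δ in 𝓝 (0 : ℝ), δ < 2 * T := eventually_lt_nhds (by linarith)
      have h2' : ∀ᶠ δ in 𝓝 (0 : ℝ), -(2 * T) < δ := eventually_gt_nhds (by linarith)
      filter_upwards [mem_nhdsWithin_of_mem_nhds h2, mem_nhdsWithin_of_mem_nhds h2'] with δ hlt hgt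
      have ha : 0 < T + δ / 2 := by linarith
      have hb : 0 < T - δ / 2 := by linarith
      rw [hu (M + 1) _ _ ha hb _ _ (hμ (M + 1) _ _ ha hb) (hμ₀ (M + 1) _ _ ha hb)]
    exact tendsto_nhds_unique ((hD (M + 1)).congr' heq) (hresp T hT M)
  obtain ⟨B, hBd⟩ := hB
  have hup : Tendsto (fun M : ℕ => D (M + 1)) atTop atTop := hdiv.congr fun M => (hval M).symm
  obtain ⟨M, hM⟩ := (hup.eventually_gt_atTop B).exists
  have hle : |D (M + 1)| ≤ B := hBd ⟨M + 1, rfl⟩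
  exact absurd (lt_of_lt_of_le hM (le_abs_self _)) (not_lt.mpr hle)

/-- **`BddAbove` is load-bearing at the harmonic corner**: the strengthening of the crux's matrix
WITHOUT the boundedness hypothesis fails for `pinnedChain ω₂ 0 0 γ` along a genuine steady family (the
Gaussian one): at `T = 1` the response sequence `D N = (N-1) c N` exists and tends to `+∞`.
[cite: BonettoLebowitzReyBellet2000, §6.2] -/
theorem boundedResponseConverges_false_without_bddAbove_harmonic {ω₂ γ : ℝ} (hω : 0 < ω₂) (hγ : 0 < γ) :
    ∃ μ : (N : ℕ) → ℝ → ℝ → Measure (PhaseSpace N),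
      (∀ (N : ℕ) (T_L T_R : ℝ), 0 < T_L → 0 < T_R →
        (pinnedChain ω₂ 0 0 γ).IsSteadyState N T_L T_R (μ N T_L T_R)) ∧
      ¬ ∀ T : ℝ, 0 < T → ∀ D : ℕ → ℝ,
        (∀ N : ℕ, Tendsto (fun δ : ℝ =>
          (pinnedChain ω₂ 0 0 γ).totalCurrent (μ N (T + δ / 2) (T - δ / 2)) / δ)
          (𝓝[≠] 0) (𝓝 (D N))) →
        ∃ k : ℝ, 0 < k ∧ Tendsto D atTop (𝓝 k) := by
  obtain ⟨μ, hμ, c, cinf, -, hresp, -, hdiv⟩ :=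
    Literature.Barriers.AtomisticToContinuum.HarmonicChainBallisticFlux_holds.ballisticLaw hω hγ
  refine ⟨μ, hμ, fun hU => ?_⟩
  let D : ℕ → ℝ := fun N => ((N - 1 : ℕ) : ℝ) * c N
  have hD : ∀ N : ℕ, Tendsto (fun δ : ℝ =>
      (pinnedChain ω₂ 0 0 γ).totalCurrent (μ N (1 + δ / 2) (1 - δ / 2)) / δ)
      (𝓝[≠] 0) (𝓝 (D N)) := by
    intro N
    cases N with
    | zero =>
      simp only [D, OscillatorChain.totalCurrent_zero, zero_div]
      norm_num
    | succ M =>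
      have h1 := hresp 1 one_pos M
      simp only [D, Nat.add_sub_cancel]
      exact h1
  obtain ⟨k, -, hk⟩ := hU 1 one_pos D hD
  have hconv : Tendsto (fun M : ℕ => D (M + 1)) atTop (𝓝 k) := hk.comp (tendsto_add_atTop_nat 1)
  have hup : Tendsto (fun M : ℕ => D (M + 1)) atTop atTop := by
    refine hdiv.congr fun M => ?_
    simp only [D, Nat.add_sub_cancel]
  exact not_tendsto_atTop_of_tendsto_nhds hconv hup

/-- **Uniqueness and `0 < γ` are jointly load-bearing (`_false_without_` uniqueness, witness
`γ = 0`).** For the bath-free chain `pinnedChain ω₂ lam β 0` (`ω₂ > 0`, `lam, β ≥ 0` — so also the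
conjunct's `lam, β > 0`) the crux's matrix WITHOUT the uniqueness antecedent is false: the Gibbs family
at the mean bath temperature is steady for all bath temperatures
(`pinnedChain_isSteadyState_gibbs_gamma_zero`) and carries no current
(`pinnedChain_totalCurrent_gibbsMeasure`), so `D ≡ 0` is an admissible bounded response sequence whose
limit is not positive — the docstring's "insulating" failure mode, realised at the boundary of the
parameter domain. [folklore] -/
theorem boundedResponseConverges_false_without_unique_gamma_zero {ω₂ lam β : ℝ} (hω : 0 < ω₂)
    (hl : 0 ≤ lam) (hβ : 0 ≤ β) :
    ¬ ∀ μ : (N : ℕ) → ℝ → ℝ → Measure (PhaseSpace N),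
      (∀ (N : ℕ) (T_L T_R : ℝ), 0 < T_L → 0 < T_R →
        (pinnedChain ω₂ lam β 0).IsSteadyState N T_L T_R (μ N T_L T_R)) →
      ∀ T : ℝ, 0 < T → ∀ D : ℕ → ℝ,
        (∀ N : ℕ, Tendsto (fun δ : ℝ =>
          (pinnedChain ω₂ lam β 0).totalCurrent (μ N (T + δ / 2) (T - δ / 2)) / δ)
          (𝓝[≠] 0) (𝓝 (D N))) →
        BddAbove (Set.range fun N => |D N|) → ∃ k : ℝ, 0 < k ∧ Tendsto D atTop (𝓝 k) := by
  intro h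
  let μ : (N : ℕ) → ℝ → ℝ → Measure (PhaseSpace N) := fun N T_L T_R =>
    (pinnedChain ω₂ lam β 0).gibbsMeasure N ((T_L + T_R) / 2)
  have hμ : ∀ (N : ℕ) (T_L T_R : ℝ), 0 < T_L → 0 < T_R →
      (pinnedChain ω₂ lam β 0).IsSteadyState N T_L T_R (μ N T_L T_R) := fun N T_L T_R h1 h2 =>
    pinnedChain_isSteadyState_gibbs_gamma_zero hω hl hβ N (by positivity) T_L T_R
  have hD : ∀ N : ℕ, Tendsto (fun δ : ℝ =>
      (pinnedChain ω₂ lam β 0).totalCurrent (μ N (1 + δ / 2) (1 - δ / 2)) / δ)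
      (𝓝[≠] 0) (𝓝 ((fun _ : ℕ => (0 : ℝ)) N)) := by
    intro N
    simp only [μ, pinnedChain_totalCurrent_gibbsMeasure, zero_div]
    exact tendsto_const_nhds
  have hB : BddAbove (Set.range fun N => |(fun _ : ℕ => (0 : ℝ)) N|) := ⟨0, by
    rintro _ ⟨N, rfl⟩
    simp⟩
  obtain ⟨k, hk, hlim⟩ := h μ hμ 1 one_pos (fun _ => 0) hD hB
  exact hk.ne' (tendsto_nhds_unique hlim tendsto_const_nhds)

/-- … whereas WITH the uniqueness antecedent the matrix is VACUOUSLY true at `γ = 0` (uniqueness fails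
there: `pinnedChain_not_unique_gamma_zero`), so `0 < γ` is not load-bearing for the truth of the typed
statement, only for the satisfiability of its antecedent. [folklore] -/
theorem boundedResponseConverges_vacuous_gamma_zero {ω₂ lam β : ℝ} (hω : 0 < ω₂) (hl : 0 ≤ lam)
    (hβ : 0 ≤ β) :
    (∀ (N : ℕ) (T_L T_R : ℝ), 0 < T_L → 0 < T_R → ∀ μ ν : Measure (PhaseSpace N),
      (pinnedChain ω₂ lam β 0).IsSteadyState N T_L T_R μ →
        (pinnedChain ω₂ lam β 0).IsSteadyState N T_L T_R ν → μ = ν) →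
    ∀ μ : (N : ℕ) → ℝ → ℝ → Measure (PhaseSpace N),
      (∀ (N : ℕ) (T_L T_R : ℝ), 0 < T_L → 0 < T_R →
        (pinnedChain ω₂ lam β 0).IsSteadyState N T_L T_R (μ N T_L T_R)) →
      ∀ T : ℝ, 0 < T → ∀ D : ℕ → ℝ,
        (∀ N : ℕ, Tendsto (fun δ : ℝ =>
          (pinnedChain ω₂ lam β 0).totalCurrent (μ N (T + δ / 2) (T - δ / 2)) / δ)
          (𝓝[≠] 0) (𝓝 (D N))) →
        BddAbove (Set.range fun N => |D N|) → ∃ k : ℝ, 0 < k ∧ Tendsto D atTop (𝓝 k) :=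
  fun hu => absurd hu (pinnedChain_not_unique_gamma_zero hω hl hβ)

/-- **Skeleton, failure mode 1 (insulating limit)**: a sequence with `D 0 = D 1 = 0`, positive and
antitone from `N = 2` on, bounded, may tend to `0` (`D N = 1/N`): an `N`-uniform LOWER bound on the
finite-size conductivity is load-bearing for `0 < k`. [folklore] -/
theorem boundedResponseConverges_skeleton_insulating :
    ∃ D : ℕ → ℝ, D 0 = 0 ∧ D 1 = 0 ∧ (∀ N, 2 ≤ N → 0 < D N) ∧
      (∀ M N, 2 ≤ M → M ≤ N → D N ≤ D M) ∧ BddAbove (Set.range fun N => |D N|) ∧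
      Tendsto D atTop (𝓝 0) ∧ ¬ ∃ k : ℝ, 0 < k ∧ Tendsto D atTop (𝓝 k) := by
  have hlim : Tendsto (fun N : ℕ => if N < 2 then (0 : ℝ) else (N : ℝ)⁻¹) atTop (𝓝 0) := by
    refine (tendsto_inv_atTop_nhds_zero_nat (𝕜 := ℝ)).congr' ?_
    filter_upwards [eventually_ge_atTop 2] with N hN
    have : ¬ N < 2 := by omega
    simp [this]
  refine ⟨fun N => if N < 2 then 0 else (N : ℝ)⁻¹, by simp, by simp, fun N hN => ?_,
    fun M N hM hMN => ?_, ⟨1, ?_⟩, hlim, ?_⟩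
  · have : ¬ N < 2 := by omega
    simp only [this, if_false]
    positivity
  · have h1 : ¬ N < 2 := by omega
    have h2 : ¬ M < 2 := by omega
    simp only [h1, h2, if_false]
    have hM' : (0 : ℝ) < M := by exact_mod_cast (by omega : 0 < M)
    exact inv_anti₀ hM' (by exact_mod_cast hMN)
  · rintro _ ⟨N, rfl⟩
    dsimp only
    split_ifs with h
    · simp
    · rw [abs_of_nonneg (by positivity)]
      have : (2 : ℝ) ≤ N := by exact_mod_cast (by omega : 2 ≤ N)
      exact inv_le_one_of_one_le₀ (by linarith)
  · rintro ⟨k, hk, hk'⟩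
    exact hk.ne' (tendsto_nhds_unique hk' hlim)

/-- **Skeleton, failure mode 2 (bounded oscillation — the mode specific to this crux, beyond
`ConductanceLowerBound`)**: a sequence with `D 0 = D 1 = 0` and `1 ≤ D N ≤ 3` for `N ≥ 2` need not
converge (`D N = 2 + (-1)^N`): even granted `N`-uniform upper AND lower bounds, a convergence
mechanism in `N` (sub- or super-additivity of the resistance, or a thermodynamic-limit identification)
is load-bearing. [folklore] -/
theorem boundedResponseConverges_skeleton_oscillating :
    ∃ D : ℕ → ℝ, D 0 = 0 ∧ D 1 = 0 ∧ (∀ N, 2 ≤ N → 1 ≤ D N ∧ D N ≤ 3) ∧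
      BddAbove (Set.range fun N => |D N|) ∧ ¬ ∃ k : ℝ, Tendsto D atTop (𝓝 k) := by
  refine ⟨fun N => if N < 2 then 0 else 2 + (-1) ^ N, by simp, by simp, fun N hN => ?_, ⟨3, ?_⟩, ?_⟩
  · have : ¬ N < 2 := by omega
    simp only [this, if_false]
    rcases neg_one_pow_eq_or ℝ N with h | h <;> rw [h] <;> norm_num
  · rintro _ ⟨N, rfl⟩
    dsimp only
    split_ifs with h
    · simp
    · rcases neg_one_pow_eq_or ℝ N with h | h <;> rw [h] <;> norm_num
  · rintro ⟨k, hlim⟩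
    have hsub_e : Tendsto (fun M : ℕ => 2 * (M + 1)) atTop atTop :=
      tendsto_atTop_atTop.2 fun b => ⟨b, fun M hM => by omega⟩
    have hsub_o : Tendsto (fun M : ℕ => 2 * (M + 1) + 1) atTop atTop :=
      tendsto_atTop_atTop.2 fun b => ⟨b, fun M hM => by omega⟩
    have he : Tendsto (fun M : ℕ => (fun N => if N < 2 then (0 : ℝ) else 2 + (-1) ^ N) (2 * (M + 1)))
        atTop (𝓝 k) := hlim.comp hsub_e
    have ho : Tendsto (fun M : ℕ => (fun N => if N < 2 then (0 : ℝ) else 2 + (-1) ^ N)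
        (2 * (M + 1) + 1)) atTop (𝓝 k) := hlim.comp hsub_o
    have he3 : Tendsto (fun M : ℕ => (fun N => if N < 2 then (0 : ℝ) else 2 + (-1) ^ N) (2 * (M + 1)))
        atTop (𝓝 3) := by
      refine tendsto_const_nhds.congr fun M => ?_
      have : ¬ 2 * (M + 1) < 2 := by omega
      simp only [this, if_false]
      rw [pow_mul]
      norm_num
    have ho1 : Tendsto (fun M : ℕ => (fun N => if N < 2 then (0 : ℝ) else 2 + (-1) ^ N)
        (2 * (M + 1) + 1)) atTop (𝓝 1) := by
      refine tendsto_const_nhds.congr fun M => ?_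
      have : ¬ 2 * (M + 1) + 1 < 2 := by omega
      simp only [this, if_false]
      rw [pow_succ, pow_mul]
      norm_num
    have h3 : k = 3 := tendsto_nhds_unique he he3
    have h1 : k = 1 := tendsto_nhds_unique ho ho1
    linarith

end Summit.AtomisticToContinuum.FouriersLaw.Theorems

end
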